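import Literature.Analysis.FluidPDE.MikadoShiftedPipes
import HarnessLib

/-!
# Separation of periodised lines on `𝕋³` by integer characters (towards De Lellis–Kwon 2022,
# Lemma 6.1 and Prop. 3.5, in quantitative form)

Analysis/FluidPDE support file on the discharge path of `Torus.DeLellisKwon2022_thm11`
(everything proved; no named facts). De Lellis–Kwon, Anal. PDE 15 (2022) = arXiv:2006.06482, §6.1,
measure the distance `dis(l_{f,p}, l_{g,q}) = min {|x - y| : x ∈ l_{f,p}, y ∈ l_{g,q}}` between the
periodisations `l_{f,p} = {λf + p} + 2πℤ³` of two lines of integer directions `f, g` and prove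
Lemma 6.1 (a shift `z`, `|z| ≤ d/4`, making all `dis(l_{f,p_f + z}, l_{g,q_g}) ≥ η`) by a
compactness-and-contradiction argument. The mechanism behind both that lemma and the elementary
"`l_{f,p} ∩ l_{g,q} = ∅` can be arranged by shifts" of §6.2 is the following QUANTITATIVE fact,
recorded here on the unit torus `𝕋³ = ℝ³/ℤ³` with the integer characters `χ_n(y) = ∑ nₗ yₗ` of
`MikadoShiftedPipes` (`Mikado.chi`): for an integer vector `n` annihilating both directions
(e.g. `n = f × g` when `f, g` are not colinear),

* `χ_n` is CONSTANT on each periodised line: `χ_n(proj (p + t f̃)) = χ_n(proj p)` (`DLK.chi_proj_add_smul`);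
* `χ_n` is `|n|₁`-Lipschitz for the sup metric of `𝕋³` (`DLK.norm_chi_sub_chi_le`);
* hence **`|n|₁ · dist(x, y) ≥ ‖χ_n(proj p) - χ_n(proj q)‖_{ℝ/ℤ}`** for all `x ∈ l_{f,p}`, `y ∈ l_{g,q}`
  (`DLK.norm_phase_sub_le_mul_dist`): two periodised lines whose phases `n·p`, `n·q` differ mod `1`
  are at distance `≥ ‖n·(p-q)‖_{ℝ/ℤ}/|n|₁`, in particular disjoint (`DLK.lines_disjoint_of_phase_ne`) —
  and shifting `p` by `z` moves the phase by `n·z`, which is how shifts separate lines.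

## References

* C. De Lellis, H. Kwon, Anal. PDE 15 (2022) = arXiv:2006.06482, §6.1 (6.1), Lemma 6.1; §6.2
  ("we can choose a finite family `{p̄_f}` of shifts with `l_{f,p̄_f} ∩ l_{g,p̄_g} = ∅`"). [DelellisKwon2022]
-/

noncomputable section

open Set Function
open scoped ContDiff

namespace Literature.Analysis.FluidPDE

namespace DLK

open FunctionSpaces FunctionSpaces.Torus Mikado

/-- Euclidean `ℝ³`, local notation. -/
local notation "ℝ³" => EuclideanSpace ℝ (Fin 3)

/-- The `ℓ¹` size `|n|₁ = ∑ |nₗ|` of an integer vector. [folklore] -/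
def normOne (n : Fin 3 → ℤ) : ℝ := ∑ l, |(n l : ℝ)|

/-- `|n|₁ ≥ 0`. [folklore] -/
theorem normOne_nonneg (n : Fin 3 → ℤ) : 0 ≤ normOne n := Finset.sum_nonneg fun _ _ => abs_nonneg _

/-- **The character is constant along a direction it annihilates**:
`χ_n(proj (p + t • f̃)) = χ_n(proj p)` when `∑ nₗ fₗ = 0`. [cite: DelellisKwon2022, §6.1 (periodised lines)] -/
theorem chi_proj_add_smul {n f : Fin 3 → ℤ} (hnf : ∑ l, n l * f l = 0) (p : ℝ³) (t : ℝ) :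
    chi n (proj (p + t • (WithLp.toLp 2 fun l => (f l : ℝ)))) = chi n (proj p) := by
  rw [chi_proj, chi_proj]
  congr 1
  have h : ∑ l, (n l : ℝ) * (p + t • (WithLp.toLp 2 fun l => (f l : ℝ))) l = ∑ l, (n l : ℝ) * p l + t * ∑ l, (n l : ℝ) * (f l : ℝ) := by
    simp only [PiLp.add_apply, PiLp.smul_apply, smul_eq_mul, mul_add, Finset.sum_add_distrib,
      Finset.mul_sum]
    congr 1
    exact Finset.sum_congr rfl fun l _ => by ring
  rw [h]
  have h0 : ∑ l, (n l : ℝ) * (f l : ℝ) = 0 := by exact_mod_cast hnf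
  rw [h0, mul_zero, add_zero]

/-- **`χ_n` is `|n|₁`-Lipschitz** on `𝕋³` (sup metric): `‖χ_n x - χ_n y‖ ≤ |n|₁ dist(x, y)`. [folklore] -/
theorem norm_chi_sub_chi_le (n : Fin 3 → ℤ) (x y : UnitAddTorus (Fin 3)) :
    ‖chi n x - chi n y‖ ≤ normOne n * dist x y := by
  rw [← map_sub, chi_apply]
  calc ‖∑ l, n l • (x - y) l‖ ≤ ∑ l, ‖n l • (x - y) l‖ := norm_sum_le _ _
    _ ≤ ∑ l, |(n l : ℝ)| * dist x y := Finset.sum_le_sum fun l _ => by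
        refine (norm_zsmul_le _ _).trans ?_
        rw [Int.norm_eq_abs]
        refine mul_le_mul_of_nonneg_left ?_ (abs_nonneg _)
        rw [Pi.sub_apply, ← dist_eq_norm]
        exact dist_le_pi_dist x y l
    _ = normOne n * dist x y := by rw [normOne, Finset.sum_mul]

/-- **Quantitative separation of periodised lines**: if `n` annihilates `f` and `g`, then for
`x = proj (p + s f̃) ∈ l_{f,p}` and `y = proj (q + t g̃) ∈ l_{g,q}`,
`‖χ_n(proj p) - χ_n(proj q)‖_{ℝ/ℤ} ≤ |n|₁ dist(x, y)`. [cite: DelellisKwon2022, Lemma 6.1 (mechanism)] -/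
theorem norm_phase_sub_le_mul_dist {n f g : Fin 3 → ℤ} (hnf : ∑ l, n l * f l = 0) (hng : ∑ l, n l * g l = 0)
    (p q : ℝ³) (s t : ℝ) :
    ‖chi n (proj p) - chi n (proj q)‖ ≤
      normOne n * dist (proj (p + s • (WithLp.toLp 2 fun l => (f l : ℝ)))) (proj (q + t • (WithLp.toLp 2 fun l => (g l : ℝ)))) := by
  rw [← chi_proj_add_smul hnf p s, ← chi_proj_add_smul hng q t]
  exact norm_chi_sub_chi_le n _ _

/-- **Lines with different phases are disjoint**: if `χ_n(proj p) ≠ χ_n(proj q)` for an `n`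
annihilating `f` and `g`, then `l_{f,p} ∩ l_{g,q} = ∅`
(§6.2: "`l_{f,p̄_f} ∩ l_{g,p̄_g} = ∅` for all `f ≠ g`"). [cite: DelellisKwon2022, §6.2] -/
theorem lines_disjoint_of_phase_ne {n f g : Fin 3 → ℤ} (hnf : ∑ l, n l * f l = 0) (hng : ∑ l, n l * g l = 0)
    {p q : ℝ³} (hpq : chi n (proj p) ≠ chi n (proj q)) (s t : ℝ) :
    proj (p + s • (WithLp.toLp 2 fun l => (f l : ℝ))) ≠ proj (q + t • (WithLp.toLp 2 fun l => (g l : ℝ))) := by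
  intro h
  have := norm_phase_sub_le_mul_dist hnf hng p q s t
  rw [h, dist_self, mul_zero, norm_le_zero_iff, sub_eq_zero] at this
  exact hpq this

/-- **Positive separation**: with `δ := ‖χ_n(proj p) - χ_n(proj q)‖ > 0` and `n ≠ 0`, every pair of
points on the two lines is at distance `≥ δ/|n|₁`. [cite: DelellisKwon2022, Lemma 6.1 (mechanism)] -/
theorem le_dist_lines {n f g : Fin 3 → ℤ} (hnf : ∑ l, n l * f l = 0) (hng : ∑ l, n l * g l = 0)
    (hn : 0 < normOne n) (p q : ℝ³) (s t : ℝ) :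
    ‖chi n (proj p) - chi n (proj q)‖ / normOne n ≤
      dist (proj (p + s • (WithLp.toLp 2 fun l => (f l : ℝ)))) (proj (q + t • (WithLp.toLp 2 fun l => (g l : ℝ)))) := by
  rw [div_le_iff₀ hn, mul_comm]
  exact norm_phase_sub_le_mul_dist hnf hng p q s t

/-- Shifting the base point moves the phase additively: `χ_n(proj (p + z)) = χ_n(proj p) + χ_n(proj z)`
(how a shift `z` with `n·z ∉ ℤ + n·(q - p)` separates `l_{f,p+z}` from `l_{g,q}`). [cite: DelellisKwon2022, Lemma 6.1] -/
theorem chi_proj_add (n : Fin 3 → ℤ) (p z : ℝ³) : chi n (proj (p + z)) = chi n (proj p) + chi n (proj z) := by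
  rw [proj_add, map_add]

end DLK

end Literature.Analysis.FluidPDE
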